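import Summits.BirchSwinnertonDyer.BirchSwinnertonDyer.Theses.KatoDescentPotSupersingular
import Summits.BirchSwinnertonDyer.BirchSwinnertonDyer.Theorems.PotSupersingularWildLowerClassTransport
import HarnessLib

/-!
# Route `KatoDescentPotSupersingular` (rung K9, B5: O6 = wild `p = 3`): the open core 19663 `WildLowerIntrinsicNonCM`
# — what the split of crux 19195 did and did not lose, in kernel form (seat bsd-potss-k9-c2, generation 5)

Bookkeeping theorems stated on the ROUTE DECLS by name (hence in a route-importing file; the mathematics is the
route-free `Theorems/PotSupersingularWildLowerClassTransport.lean`, p444599):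

* `wildLowerIntrinsicNonCM_of_wildLowerHalfRankZero` — the child is a restriction of the parent (no inputs);
* `wildLowerHalfRankZero_iff_wildLowerIntrinsicNonCM` — modulo the four held published inputs (Cassels 19619,
  GZK 19620, modularity 19621, the CM triple 19622) the parent 19195 and the open core 19663 are EQUIVALENT: the
  split is lossless;
* `wildLowerIntrinsicNonCM_iff_minimalMember` — modulo the three transport inputs the open core is EQUIVALENT to
  L₀ at ONE curve per class, the `Ш_an`-minimal globally minimal member (displayed ∀-statement; the open content
  of rung K9's lower half is `3 ^ ord₃ #Ш_an(W₀) ∣ #Ш(W₀)` at that member of each intrinsic non-CM wild class);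
* `shaFinite_of_wildLowerIntrinsicNonCM` — a STRENGTH remark for the tribunal record: the bare crux 19663 already
  contains the finiteness of `Ш(W)` on its rows with rational `#Ш_an` (because `MissingLowerBoundAt W 3` with
  `ord₃ #Ш_an(W) > 0` forces `ord₃ (Nat.card Ш) > 0`, and `Nat.card` of an infinite group is the junk value `0`) —
  i.e. any future proof of 19663 is at least modulo Gross–Zagier–Kolyvagin finiteness on those rows (a theorem in
  print, the route's input 19620), never literally unconditional in the tree's current state.

Nothing is booked; 19663 stays OPEN (Kato's Conj. 12.10 lower inclusion at the additive prime `3` on the intrinsic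
non-CM O6 classes — no `p`-adic `L`-function or main conjecture exists in print there); BSD is not proved by any
of this.

References: [MilneADT2006] Thm. I.7.3; [Miller2011LMS] §1, Def. 1.1; [Kolyvagin1990]; [GrossZagier1986];
[Kato2004Asterisque] Conj. 12.10 (p. 224).
-/

set_option autoImplicit false
-- sibling precedent (`KatoDescentPotSupersingularAssembly.lean`): the directory name repeats the summit name
set_option linter.dupNamespace false

noncomputable section

open scoped Classical

namespace Summit.BirchSwinnertonDyer.BirchSwinnertonDyer.Theorems

open WeierstrassCurve Literature.NumberTheory.EllipticCurves
  Literature.NumberTheory.EllipticCurves.Rank1Residual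
  Literature.NumberTheory.EllipticCurves.Rank1Residual.Typed
  Summit.BirchSwinnertonDyer.Rank1Residual.Additive
  Summit.BirchSwinnertonDyer.BirchSwinnertonDyer.Theses.KatoDescentPotSupersingular

/-- The open core 19663 is a restriction of the parent crux 19195 (no inputs needed). Bookkeeping.
[cite: Miller2011LMS, §1 and Def. 1.1] -/
theorem wildLowerIntrinsicNonCM_of_wildLowerHalfRankZero (h : WildLowerHalfRankZero) :
    WildLowerIntrinsicNonCM :=
  fun W _ _ _ hr hO6 _ _ => h W hr hO6

/-- **The split of 19195 is lossless**: modulo the four held published inputs of the glue 19664 (Cassels'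
isogeny invariance, GZK, modularity, the CM rank-zero triple) the parent crux `WildLowerHalfRankZero` and its
open core `WildLowerIntrinsicNonCM` are equivalent (`wild_lowerHalf_of_intrinsicNonCMRows`, p444599, one way; plain
restriction the other). [cite: MilneADT2006, Thm. I.7.3] [cite: Miller2011LMS, §1 and Def. 1.1] -/
theorem wildLowerHalfRankZero_iff_wildLowerIntrinsicNonCM (hC : PublishedInputCasselsIsogenyW)
    (hG : PublishedInputRankEqAnalyticRankW) (hM : PublishedInputEntireLFunctionW)
    (hCM : PublishedInputCMRankZeroBSDW) : WildLowerHalfRankZero ↔ WildLowerIntrinsicNonCM :=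
  ⟨wildLowerIntrinsicNonCM_of_wildLowerHalfRankZero,
    fun hI => wild_lowerHalf_of_intrinsicNonCMRows hC hG hM hCM hI⟩

/-- **One curve per class**: modulo Cassels' isogeny invariance, GZK and modularity (the held inputs 19619–19621)
the open core `WildLowerIntrinsicNonCM` is equivalent to L₀ at the `Ш_an`-MINIMAL globally minimal member `W₀` of
the isogeny class of each non-CM wild analytic-rank-`0` curve (`3 ∣ #Ш_an(W₀)` and `ord₃ #Ш_an(W₀) ≤ ord₃ #Ш_an(W')`
for every globally minimal member `W'` with rational `#Ш_an`) — the displayed ∀-statement; proof =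
`wild_minimalMemberRows_of_intrinsicNonCMRows` / `wild_intrinsicNonCMRows_of_minimalMemberRows` (p444599). So the
open content of rung K9's lower half is one divisibility per intrinsic non-CM wild class:
`3 ^ ord₃ #Ш_an(W₀) ∣ #Ш(W₀)`. [cite: MilneADT2006, Thm. I.7.3] [cite: Miller2011LMS, §1 and Def. 1.1]
[cite: Kato2004Asterisque, Conj. 12.10 (p. 224)] -/
theorem wildLowerIntrinsicNonCM_iff_minimalMember (hC : PublishedInputCasselsIsogenyW)
    (hG : PublishedInputRankEqAnalyticRankW) (hM : PublishedInputEntireLFunctionW) :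
    WildLowerIntrinsicNonCM ↔
    ∀ (W : WeierstrassCurve ℚ) [W.IsElliptic] [W.IsGloballyMinimal] [Fact (3 : ℕ).Prime],
      W.analyticRank = 0 → ClassO6 W 3 → ¬ W.HasCM →
      ∀ (W₀ : WeierstrassCurve ℚ) [W₀.IsElliptic] [W₀.IsGloballyMinimal], IsIsogenous W W₀ →
      (∀ q₀ : ℚ, shaAn W₀ = (q₀ : ℂ) → 0 < padicValRat 3 q₀ ∧
        ∀ (W' : WeierstrassCurve ℚ) [W'.IsElliptic] [W'.IsGloballyMinimal], IsIsogenous W W' →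
          ∀ q' : ℚ, shaAn W' = (q' : ℂ) → padicValRat 3 q₀ ≤ padicValRat 3 q') →
      MissingLowerBoundAt W₀ 3 :=
  ⟨fun h => wild_minimalMemberRows_of_intrinsicNonCMRows hC hG hM h,
    fun h => wild_intrinsicNonCMRows_of_minimalMemberRows hC hG hM h⟩

/-- **Strength remark (tribunal record).** The bare crux `WildLowerIntrinsicNonCM` implies the finiteness of
`Ш(W)` for every non-CM wild analytic-rank-`0` curve `W` whose class is intrinsic and whose `#Ш_an(W) = q` is
rational: `MissingLowerBoundAt W 3` gives `0 < ord₃ q ≤ ord₃ (Nat.card Ш(W))`, and `Nat.card` of an infinite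
group is `0` (`padicValNat 3 0 = 0`). Hence any proof of 19663 is at least modulo Gross–Zagier–Kolyvagin finiteness
on those rows (a theorem in print: the route's held input 19620) — the crux cannot be closed "unconditionally"
in the tree's present state without it. Bookkeeping; nothing booked. [cite: Kolyvagin1990] [cite: GrossZagier1986]
[cite: Miller2011LMS, Def. 1.1] -/
theorem shaFinite_of_wildLowerIntrinsicNonCM (h : WildLowerIntrinsicNonCM)
    (W : WeierstrassCurve ℚ) [W.IsElliptic] [W.IsGloballyMinimal] [Fact (3 : ℕ).Prime]
    (hr : W.analyticRank = 0) (hO6 : ClassO6 W 3) (hcm : ¬ W.HasCM)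
    (hintr : ∀ (W' : WeierstrassCurve ℚ) [W'.IsElliptic] [W'.IsGloballyMinimal], IsIsogenous W W' →
      ∀ q' : ℚ, shaAn W' = (q' : ℂ) → 0 < padicValRat 3 q')
    {q : ℚ} (hq : shaAn W = (q : ℂ)) : W.ShaFinite := by
  obtain ⟨r, hr', hle⟩ := h W hr hO6 hcm hintr
  have hrq : r = q := by exact_mod_cast hr'.symm.trans hq
  subst hrq
  have hpos : 0 < padicValRat 3 r := hintr W (isIsogenous_self W) r hq
  have hv : 0 < padicValNat 3 W.shaOrder := by exact_mod_cast hpos.trans_le hle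
  have hne : W.shaOrder ≠ 0 := by
    intro h0
    rw [h0, padicValNat_zero_right] at hv
    exact lt_irrefl 0 hv
  -- `Nat.card Ш ≠ 0` forces finiteness
  exact Nat.finite_of_card_ne_zero hne

end Summit.BirchSwinnertonDyer.BirchSwinnertonDyer.Theorems

end
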